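/-
Copyright (c) 2026 the pub-hodgecm-mathlib formalisation cell (harness21).  Prover seat hodgecm-mathlib-LH4-p08 (g4), Track A «(D-RAM) FOUR-FRAME», unit U2H, the census leaf
(ρ2b′-X) `stub_U2H_fixedPointCensus_typeTwo_unit0` — dealer LH4-plan (g12) WORD #16 hand T5a «TORIC LEVEL CENSUS, K-UNRAMIFIED» (payer of record LH4-p14 (g3); plan owner
LH4-p12 (g4) T5-FRAME v1 «a character sum over the third field K♮»): Mars' unit-depth index read in the ONE-FIELD VALUED DATUM currency.  2026-09-04.
-/
import Literature.NumberTheory.LocalFields.RamifiedQuadraticOrderUnitIndexWild   -- ★ Mars (DVR currency): `[Sˣ : {σu ≡ u (𝔪^{d+2j})}] = q^j`; brings ★ `mem_comap_eqLocus_iff`, `maximalIdeal_pow_le_comap`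
import Literature.NumberTheory.LocalFields.WildQuadraticDatumTrace                 -- ★ `map_varpi_ne`, `even_log_v_of_fixed` (this namespace); brings ★ `WildQuadraticEisensteinFrame` (`exists_fixed_coords_of_map_ne`, (Π5) `v_fixed_add_fixed_mul_le_one_iff`)
import Literature.NumberTheory.Automorphic.UnitaryThreePHTowerRho                  -- ★ `mem_maximalIdeal_pow_iff_v_le` (`y ∈ 𝓂^m ↔ |y| ≤ |ϖ^m|`)
import HarnessLib

/-!
# The unit-depth index of a RAMIFIED QUADRATIC DATUM in valued-field currency: `[𝒪ˣ : {u : |σu − u| ≤ |ϖ|^{d+2j}}] = q^j`, every depth `≤ d` automatic, no odd steps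
(Flicker 1998 Prop. 7 p. 84 ∕ §6 p. 95 REMARK (Mars); Serre, *Local Fields* Ch. IV §1, Ch. V §1, §3)

Topic `NumberTheory/LocalFields`; namespace `Literature.NumberTheory.LocalFields.WildQuadraticDatum` (the one-field datum of ★ `WildQuadraticDatumTrace`: `σ` an isometric involution of a
discretely valued field `K`, non-zero `σ`-fixed elements of even valuation, `ϖ` a uniformiser, `|ϖ − σϖ| = |ϖ|^d`; datum conjuncts as separate binders).  THEOREMS ONLY (no definition,
no instance, no notation, no named fact, no `sorry`); kernel lane `--supports stmt-HodgeConjecture-24833` (count-neutral).  Cell `pub/hodgecm-mathlib` (D-0151), crux H413, Track A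
«(D-RAM) FOUR-FRAME», unit U2H: in the toric ∕ order reduction of the WILD type-(2) fixed-point census (ρ2b′-X) the per-level lattice counts are FIBRE COUNTS on the unit filtration of
the third quadratic field `K♮ ∕ F` (this seat's T5a sheet (M6); LH4-p12 (g4) T5-FRAME v1 §2 F2∕F4; F0P3a-p01 (g32) E1 v1 §E U2), i.e. the index `[𝒪_{K♮}ˣ : V_k]` of
`V_k = {u : |σu − u| ≤ |ϖ|^k}`.  That index is ★ in DVR currency — Mars' theorem ★ `RamifiedQuadraticOrder.index_comap_eqLocus_add_two_mul_eq_pow` for a DVR `S` with an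
involution, an irreducible `τ`, an Eisenstein basis over the fixed ring and the different as an ideal equation — and ★ at a CM place (`RamifiedPlaceOrderUnitIndex`, valuation letters
of `L_w ∕ L⁺_v`).  THIS FILE instantiates Mars at `S = 𝒪[K]` for an ABSTRACT valued field carrying a ramified quadratic datum (the frame T3∕T5 hand over for `K♮`, which is NOT a
CM completion), discharging his four structural hypotheses from the datum:
* §1 the involution RESTRICTS to `𝒪[K]` (`exists_ringHom_integer`; all later statements take the restriction `σO` with `hσO : (σO x : K) = σ x` as a binder — no definition);
  `σO` is an involution; the uniformiser `τ = ⟨ϖ, _⟩` is IRREDUCIBLE in `𝒪[K]` (valuation count, no DVR API); the EISENSTEIN BASIS `x = a + b·τ` over the fixed ring (★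
  `exists_fixed_coords_of_map_ne` + ★ (Π5) integrality from the fixed parity ★ `even_log_v_of_fixed`); the DIFFERENT `(σO τ − τ) = 𝓂^d` as an ideal equation (★ `mem_maximalIdeal_pow_iff_v_le`).
* §2 MEMBERSHIP: `u ∈` Mars' level-`k` subgroup `⟺ |σu − u| ≤ |ϖ^k|`; HEAD **`index_depth_eq_pow`**: `[𝒪[K]ˣ : {u : |σu − u| ≤ |ϖ|^{d+2j}}] = q^j` (`q = #𝓀[K]`), odd levels
  `d + 2j + 1 ↦ q^{j+1}`, levels `≤ d` have index `1`.
* §3 THE SAME IN `Kˣ` (binder-characterised subgroups, ★ `RamifiedPlaceOrderUnitIndex` style, def-free): for `U, V ≤ Kˣ` with `u ∈ U ↔ |u| = 1`,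
  `u ∈ V ↔ |u| = 1 ∧ |σu − u| ≤ |ϖ^{d+2j}|`: **`V.relIndex U = q^j`** (`relIndex_eq_pow_of_depth`), and such `V` EXIST (`exists_subgroup_depth`).
* §4 (ED. 2, append-only) the ODD levels `d + 2j + 1 ↦ q^{j+1}` and the LOW levels `k ≤ d ↦ 1` in the same `Kˣ` form (`relIndex_eq_pow_of_depth_odd`, `relIndex_eq_one_of_depth_le`)
  — so a consumer can evaluate `[U : V_k]` at EVERY `k` (= `q^{⌈(k−d)∕2⌉₊}`).
HONEST LABEL: HC_CM is proved only modulo the 7 printed citations (2 remaining named inputs: hLiu418 = stmt-HodgeConjecture-24832, h413 = stmt-HodgeConjecture-24833) until rung 0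
closes; unconditional local algebra, count-neutral (★-instantiation; organ U2∕F2 input of the (ρ2b′-X) payer plan, nothing of the census asserted).

## References
* [Flicker1998UnitaryFL] Y. Z. Flicker, *Elementary proof of the fundamental lemma for a unitary group*, Canad. J. Math. 50 (1998): Prop. 7 p. 84; §6 p. 95 REMARK (J. G. M. Mars:
  `[R_E^× : R_E(j)^×]`, `e = 2` wild included).
* [Serre1979] J.-P. Serre, *Local Fields*, GTM 67 (1979): Ch. I §6 Prop. 18 (Eisenstein basis `𝒪_E = 𝒪_F ⊕ 𝒪_F ϖ`), Ch. IV §1 Prop. 3–4 (`i_G(σ) = ord(σϖ − ϖ)`), Ch. V §1, §3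
  (the filtration `U^{(n)}`).
-/

set_option autoImplicit false

open WithZero IsLocalRing
open scoped Valued

namespace Literature.NumberTheory.LocalFields.WildQuadraticDatum

open Literature.NumberTheory.LocalFields Literature.NumberTheory.LocalFields.UnramifiedQuadraticNorm Literature.NumberTheory.LocalFields.RamifiedQuadraticOrder
open Literature.NumberTheory.Automorphic.UnitaryGroup (mem_maximalIdeal_pow_iff_v_le)

variable {K : Type*} [Field K] [Valued K ℤᵐ⁰] {σ : K →+* K} {ϖ : K} {d : ℕ}

/-! ## §1 The datum in DVR letters on `𝒪[K]`: restriction of `σ`, irreducibility of `ϖ`, Eisenstein basis, the different as an ideal -/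

/-- An ISOMETRIC endomorphism RESTRICTS to the valuation ring: there is `σO : 𝒪[K] →+* 𝒪[K]` with `(σO x : K) = σ x` (existence only — no definition is introduced; every later
statement takes such a `σO` as a binder). [cite: Serre1979, Ch. V §1] -/
theorem exists_ringHom_integer (hvσ : ∀ a, Valued.v (σ a) = Valued.v a) :
    ∃ σO : 𝒪[K] →+* 𝒪[K], ∀ x : 𝒪[K], ((σO x : 𝒪[K]) : K) = σ x :=
  ⟨σ.restrict 𝒪[K] 𝒪[K] fun x hx => by
      rw [Valued.integer, Valuation.mem_integer_iff] at hx ⊢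
      rwa [hvσ], fun _ => rfl⟩

/-- The restriction of an involution is an involution. [cite: Serre1979, Ch. V §1] -/
theorem ringHom_integer_involutive (hσ : ∀ x, σ (σ x) = x) {σO : 𝒪[K] →+* 𝒪[K]} (hσO : ∀ x : 𝒪[K], ((σO x : 𝒪[K]) : K) = σ x) (x : 𝒪[K]) :
    σO (σO x) = x :=
  Subtype.ext (by rw [hσO, hσO, hσ])

/-- `σO x − x` read in `K` is `σx − x`. [cite: Serre1979, Ch. V §1] -/
theorem coe_ringHom_integer_sub {σO : 𝒪[K] →+* 𝒪[K]} (hσO : ∀ x : 𝒪[K], ((σO x : 𝒪[K]) : K) = σ x) (x : 𝒪[K]) :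
    ((σO x - x : 𝒪[K]) : K) = σ x - x := by
  rw [AddSubgroupClass.coe_sub, hσO]

/-- `|ϖ| = exp(−1) ≤ 1`: the uniformiser is an integer. [cite: Serre1979, Ch. V §1] -/
theorem v_varpi_le_one (hϖ : Valued.v ϖ = exp (-1 : ℤ)) : Valued.v ϖ ≤ 1 := by
  rw [hϖ, ← exp_zero, exp_le_exp]; norm_num

/-- **THE UNIFORMISER IS IRREDUCIBLE IN `𝒪[K]`** (`|ϖ| = exp(−1)`): it is not a unit, and in a factorisation `ϖ = a·b` inside `𝒪[K]` one factor has valuation `1` (two values `≤ exp(−1)`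
multiply to `≤ exp(−2) < exp(−1)`).  Valuation count only — no DVR hypothesis. [cite: Serre1979, Ch. I §6 Prop. 18] -/
theorem irreducible_varpi (hϖ : Valued.v ϖ = exp (-1 : ℤ)) : Irreducible (⟨ϖ, v_varpi_le_one hϖ⟩ : 𝒪[K]) := by
  have hunit : ∀ z : 𝒪[K], IsUnit z ↔ Valued.v (z : K) = 1 := fun z =>
    (Valuation.integer.integers (Valued.v (R := K))).isUnit_iff_valuation_eq_one
  refine ⟨fun h => ?_, fun a b hab => ?_⟩
  · have := (hunit _).1 h
    simp only [hϖ, ← exp_zero, exp_inj] at this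
    norm_num at this
  · have hv : Valued.v (a : K) * Valued.v (b : K) = exp (-1 : ℤ) := by
      rw [← map_mul, ← Subring.coe_mul, ← hab, hϖ]
    by_contra hcon
    rw [not_or, hunit, hunit] at hcon
    have ha : Valued.v (a : K) ≤ exp (-1 : ℤ) := (lt_one_iff_le_exp_neg_one _).1 (lt_of_le_of_ne a.2 hcon.1)
    have hb : Valued.v (b : K) ≤ exp (-1 : ℤ) := (lt_one_iff_le_exp_neg_one _).1 (lt_of_le_of_ne b.2 hcon.2)
    have := mul_le_mul' ha hb
    rw [hv, ← exp_add, exp_le_exp] at this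
    norm_num at this

/-- **THE EISENSTEIN BASIS OVER THE FIXED RING, IN `𝒪[K]`**: every integer is `a + b·ϖ` with `a, b` `σO`-FIXED INTEGERS (field coordinates ★ `exists_fixed_coords_of_map_ne`, integrality of
the coordinates ★ (Π5) `v_fixed_add_fixed_mul_le_one_iff` from the fixed parity) — Mars' `hbasis`. [cite: Serre1979, Ch. I §6 Prop. 18] -/
theorem exists_fixed_coords_integer (hσ : ∀ x, σ (σ x) = x) (hfix : ∀ x : K, σ x = x → x ≠ 0 → ∃ n : ℤ, Valued.v x = exp (2 * n))
    (hϖ : Valued.v ϖ = exp (-1 : ℤ)) (hσϖ : σ ϖ ≠ ϖ)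
    {σO : 𝒪[K] →+* 𝒪[K]} (hσO : ∀ x : 𝒪[K], ((σO x : 𝒪[K]) : K) = σ x) (x : 𝒪[K]) :
    ∃ a b : 𝒪[K], σO a = a ∧ σO b = b ∧ x = a + b * ⟨ϖ, v_varpi_le_one hϖ⟩ := by
  obtain ⟨a, b, ha, hb, hx⟩ := exists_fixed_coords_of_map_ne hσ hσϖ (x : K)
  have hint := (v_fixed_add_fixed_mul_le_one_iff (even_log_v_of_fixed hfix) hϖ ha hb).1 (hx ▸ x.2)
  refine ⟨⟨a, hint.1⟩, ⟨b, hint.2⟩, Subtype.ext (by rw [hσO]; exact ha), Subtype.ext (by rw [hσO]; exact hb), Subtype.ext ?_⟩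
  simpa using hx

/-- **THE DIFFERENT AS AN IDEAL EQUATION**: `(σO ϖ − ϖ)·𝒪[K] = 𝓂^d` (`|ϖ − σϖ| = |ϖ|^d`; a principal ideal of a valuation ring is determined by the valuation of a generator —
★ `mem_maximalIdeal_pow_iff_v_le`).  Mars' `hd`. [cite: Serre1979, Ch. IV §1 Prop. 4] -/
theorem span_map_varpi_sub_eq_pow (hϖ : Valued.v ϖ = exp (-1 : ℤ)) (hdd : Valued.v (ϖ - σ ϖ) = Valued.v ϖ ^ d)
    {σO : 𝒪[K] →+* 𝒪[K]} (hσO : ∀ x : 𝒪[K], ((σO x : 𝒪[K]) : K) = σ x) :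
    Ideal.span {σO ⟨ϖ, v_varpi_le_one hϖ⟩ - ⟨ϖ, v_varpi_le_one hϖ⟩} = 𝓂[K] ^ d := by
  set s : 𝒪[K] := σO ⟨ϖ, v_varpi_le_one hϖ⟩ - ⟨ϖ, v_varpi_le_one hϖ⟩ with hs_def
  have hsK : (s : K) = σ ϖ - ϖ := by rw [hs_def, AddSubgroupClass.coe_sub, hσO]
  have hvs : Valued.v (s : K) = Valued.v (ϖ ^ d) := by
    rw [hsK, ← neg_sub, Valuation.map_neg, hdd, map_pow]
  have hs0 : (s : K) ≠ 0 := fun h0 => by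
    rw [h0, map_zero, map_pow, hϖ, ← exp_nsmul] at hvs
    exact (exp_ne_zero hvs.symm).elim
  apply le_antisymm
  · rw [Ideal.span_singleton_le_iff_mem, mem_maximalIdeal_pow_iff_v_le hϖ]
    exact hvs.le
  · intro y hy
    rw [mem_maximalIdeal_pow_iff_v_le hϖ] at hy
    rw [Ideal.mem_span_singleton]
    have hq : Valued.v ((y : K) / s) ≤ 1 := by
      rw [map_div₀, hvs]; exact div_le_one_of_le₀ hy zero_le
    refine ⟨⟨(y : K) / s, hq⟩, Subtype.ext ?_⟩
    simp only [Subring.coe_mul]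
    rw [mul_div_cancel₀ _ hs0]

/-! ## §2 Mars' subgroups in valuation letters and the HEAD -/

section Index

variable [IsDiscreteValuationRing 𝒪[K]]

/-- **MEMBERSHIP IN VALUATION LETTERS**: a unit `u` of `𝒪[K]` lies in Mars' level-`k` subgroup `{σ̄_k u = u}` iff `|σu − u| ≤ |ϖ^k|` (★ `mem_comap_eqLocus_iff` +
★ `mem_maximalIdeal_pow_iff_v_le`). [cite: Flicker1998UnitaryFL, Prop. 7 p. 84] [cite: Serre1979, Ch. V §1] -/
theorem mem_depthSubgroup_iff (hσ : ∀ x, σ (σ x) = x) (hϖ : Valued.v ϖ = exp (-1 : ℤ))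
    {σO : 𝒪[K] →+* 𝒪[K]} (hσO : ∀ x : 𝒪[K], ((σO x : 𝒪[K]) : K) = σ x) (k : ℕ) (u : (𝒪[K])ˣ) :
    u ∈ ((Units.map (Ideal.quotientMap (maximalIdeal 𝒪[K] ^ k) σO
            (maximalIdeal_pow_le_comap σO (ringHom_integer_involutive hσ hσO) k)).toMonoidHom).eqLocus (MonoidHom.id _)).comap
          (Units.map (Ideal.Quotient.mk (maximalIdeal 𝒪[K] ^ k)).toMonoidHom) ↔
      Valued.v (σ (u : 𝒪[K]) - (u : 𝒪[K]) : K) ≤ Valued.v (ϖ ^ k) := by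
  rw [mem_comap_eqLocus_iff σO (ringHom_integer_involutive hσ hσO) k u, show maximalIdeal 𝒪[K] = 𝓂[K] from rfl,
    mem_maximalIdeal_pow_iff_v_le hϖ, coe_ringHom_integer_sub hσO]

/-- **HEAD — MARS' INDEX FOR A VALUED RAMIFIED QUADRATIC DATUM**: `[𝒪[K]ˣ : {u : |σu − u| ≤ |ϖ|^{d+2j}}] = q^j`, `q = #𝓀[K]`, ANY residue characteristic (wild `d ≥ 2` included),
by ★ `index_comap_eqLocus_add_two_mul_eq_pow` at `S = 𝒪[K]` with §1's four discharges. [cite: Flicker1998UnitaryFL, Prop. 7 p. 84; §6 p. 95 REMARK] [cite: Serre1979, Ch. IV §1 Prop. 3–4, Ch. V §3] -/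
theorem index_depth_eq_pow (hσ : ∀ x, σ (σ x) = x)
    (hfix : ∀ x : K, σ x = x → x ≠ 0 → ∃ n : ℤ, Valued.v x = exp (2 * n))
    (hϖ : Valued.v ϖ = exp (-1 : ℤ)) (hdd : Valued.v (ϖ - σ ϖ) = Valued.v ϖ ^ d)
    {σO : 𝒪[K] →+* 𝒪[K]} (hσO : ∀ x : 𝒪[K], ((σO x : 𝒪[K]) : K) = σ x)
    [Finite 𝓀[K]] {q : ℕ} (hq : Nat.card 𝓀[K] = q) (j : ℕ) :
    (((Units.map (Ideal.quotientMap (maximalIdeal 𝒪[K] ^ (d + 2 * j)) σO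
            (maximalIdeal_pow_le_comap σO (ringHom_integer_involutive hσ hσO) (d + 2 * j))).toMonoidHom).eqLocus (MonoidHom.id _)).comap
          (Units.map (Ideal.Quotient.mk (maximalIdeal 𝒪[K] ^ (d + 2 * j))).toMonoidHom)).index = q ^ j :=
  index_comap_eqLocus_add_two_mul_eq_pow σO (ringHom_integer_involutive hσ hσO) (irreducible_varpi hϖ)
    (exists_fixed_coords_integer hσ hfix hϖ (map_varpi_ne hϖ hdd) hσO) (span_map_varpi_sub_eq_pow hϖ hdd hσO) hq j

/-- **ODD LEVELS ∕ NO ODD STEPS**: `[𝒪[K]ˣ : {u : |σu − u| ≤ |ϖ|^{d+2j+1}}] = q^{j+1}` (★ `index_comap_eqLocus_add_odd_eq_pow`). [cite: Serre1979, Ch. IV §1 Prop. 3, Ch. V §3]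
[cite: Flicker1998UnitaryFL, Prop. 7 p. 84] -/
theorem index_depth_odd_eq_pow (hσ : ∀ x, σ (σ x) = x)
    (hfix : ∀ x : K, σ x = x → x ≠ 0 → ∃ n : ℤ, Valued.v x = exp (2 * n))
    (hϖ : Valued.v ϖ = exp (-1 : ℤ)) (hdd : Valued.v (ϖ - σ ϖ) = Valued.v ϖ ^ d)
    {σO : 𝒪[K] →+* 𝒪[K]} (hσO : ∀ x : 𝒪[K], ((σO x : 𝒪[K]) : K) = σ x)
    [Finite 𝓀[K]] {q : ℕ} (hq : Nat.card 𝓀[K] = q) (j : ℕ) :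
    (((Units.map (Ideal.quotientMap (maximalIdeal 𝒪[K] ^ (d + (2 * j + 1))) σO
            (maximalIdeal_pow_le_comap σO (ringHom_integer_involutive hσ hσO) (d + (2 * j + 1)))).toMonoidHom).eqLocus (MonoidHom.id _)).comap
          (Units.map (Ideal.Quotient.mk (maximalIdeal 𝒪[K] ^ (d + (2 * j + 1)))).toMonoidHom)).index = q ^ (j + 1) :=
  index_comap_eqLocus_add_odd_eq_pow σO (ringHom_integer_involutive hσ hσO) (irreducible_varpi hϖ)
    (exists_fixed_coords_integer hσ hfix hϖ (map_varpi_ne hϖ hdd) hσO) (span_map_varpi_sub_eq_pow hϖ hdd hσO) hq j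

/-- **DEPTHS `≤ d` ARE AUTOMATIC**: the level-`k` subgroup is everything for `k ≤ d` (★ `index_comap_eqLocus_eq_one_of_le`: `σu − u = b·(σϖ − ϖ) ∈ 𝓂^d` for every integer).
[cite: Serre1979, Ch. IV §1 Prop. 4] -/
theorem index_depth_eq_one_of_le (hσ : ∀ x, σ (σ x) = x)
    (hfix : ∀ x : K, σ x = x → x ≠ 0 → ∃ n : ℤ, Valued.v x = exp (2 * n))
    (hϖ : Valued.v ϖ = exp (-1 : ℤ)) (hdd : Valued.v (ϖ - σ ϖ) = Valued.v ϖ ^ d)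
    {σO : 𝒪[K] →+* 𝒪[K]} (hσO : ∀ x : 𝒪[K], ((σO x : 𝒪[K]) : K) = σ x) {k : ℕ} (hk : k ≤ d) :
    (((Units.map (Ideal.quotientMap (maximalIdeal 𝒪[K] ^ k) σO
            (maximalIdeal_pow_le_comap σO (ringHom_integer_involutive hσ hσO) k)).toMonoidHom).eqLocus (MonoidHom.id _)).comap
          (Units.map (Ideal.Quotient.mk (maximalIdeal 𝒪[K] ^ k)).toMonoidHom)).index = 1 :=
  index_comap_eqLocus_eq_one_of_le σO (ringHom_integer_involutive hσ hσO) (irreducible_varpi hϖ)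
    (exists_fixed_coords_integer hσ hfix hϖ (map_varpi_ne hϖ hdd) hσO) (span_map_varpi_sub_eq_pow hϖ hdd hσO) hk

/-! ## §3 The same index between binder-characterised subgroups of `Kˣ` (def-free consumer form) -/

omit [IsDiscreteValuationRing 𝒪[K]] in
/-- The embedding `𝒪[K]ˣ → Kˣ` is injective and its image is `{u : |u| = 1}`. [cite: Serre1979, Ch. V §1] -/
theorem range_units_map_subtype (U : Subgroup Kˣ) (hU : ∀ u, u ∈ U ↔ Valued.v (u : K) = 1) :
    (Units.map (𝒪[K]).subtype.toMonoidHom).range = U ∧ Function.Injective (Units.map (𝒪[K]).subtype.toMonoidHom : (𝒪[K])ˣ →* Kˣ) := by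
  have hunit : ∀ z : 𝒪[K], IsUnit z ↔ Valued.v (z : K) = 1 := fun z =>
    (Valuation.integer.integers (Valued.v (R := K))).isUnit_iff_valuation_eq_one
  refine ⟨?_, ?_⟩
  · ext u
    rw [hU, MonoidHom.mem_range]
    constructor
    · rintro ⟨w, rfl⟩
      exact (hunit (w : 𝒪[K])).1 w.isUnit
    · intro hu
      have hu1 : Valued.v (u : K) ≤ 1 := hu.le
      obtain ⟨w, hw⟩ := (hunit ⟨(u : K), hu1⟩).2 hu
      refine ⟨w, Units.ext ?_⟩
      have := congrArg (fun z : 𝒪[K] => (z : K)) hw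
      simpa using this
  · intro a b hab
    have := congrArg (fun u : Kˣ => (u : K)) hab
    exact Units.ext (Subtype.ext (by simpa using this))

/-- **THE INDEX IN `Kˣ`**: for subgroups `U, V ≤ Kˣ` characterised by `u ∈ U ↔ |u| = 1` and `u ∈ V ↔ |u| = 1 ∧ |σu − u| ≤ |ϖ^{d+2j}|`, **`V.relIndex U = q^j`**
(the image of §2 under the injective embedding `𝒪[K]ˣ ↪ Kˣ`, `Subgroup.relIndex_map_map_of_injective`). [cite: Flicker1998UnitaryFL, Prop. 7 p. 84] [cite: Serre1979, Ch. V §3] -/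
theorem relIndex_eq_pow_of_depth (hσ : ∀ x, σ (σ x) = x) (hvσ : ∀ a, Valued.v (σ a) = Valued.v a)
    (hfix : ∀ x : K, σ x = x → x ≠ 0 → ∃ n : ℤ, Valued.v x = exp (2 * n))
    (hϖ : Valued.v ϖ = exp (-1 : ℤ)) (hdd : Valued.v (ϖ - σ ϖ) = Valued.v ϖ ^ d)
    [Finite 𝓀[K]] {q : ℕ} (hq : Nat.card 𝓀[K] = q) (j : ℕ) (U V : Subgroup Kˣ)
    (hU : ∀ u, u ∈ U ↔ Valued.v (u : K) = 1)
    (hV : ∀ u, u ∈ V ↔ Valued.v (u : K) = 1 ∧ Valued.v (σ (u : K) - u) ≤ Valued.v (ϖ ^ (d + 2 * j))) :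
    V.relIndex U = q ^ j := by
  obtain ⟨σO, hσO⟩ := exists_ringHom_integer hvσ
  set f : (𝒪[K])ˣ →* Kˣ := Units.map (𝒪[K]).subtype.toMonoidHom with hf
  set M : Subgroup (𝒪[K])ˣ :=
    ((Units.map (Ideal.quotientMap (maximalIdeal 𝒪[K] ^ (d + 2 * j)) σO
          (maximalIdeal_pow_le_comap σO (ringHom_integer_involutive hσ hσO) (d + 2 * j))).toMonoidHom).eqLocus (MonoidHom.id _)).comap
      (Units.map (Ideal.Quotient.mk (maximalIdeal 𝒪[K] ^ (d + 2 * j))).toMonoidHom) with hM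
  obtain ⟨hrange, hinj⟩ := range_units_map_subtype (K := K) U hU
  have hunit : ∀ z : 𝒪[K], IsUnit z ↔ Valued.v (z : K) = 1 := fun z =>
    (Valuation.integer.integers (Valued.v (R := K))).isUnit_iff_valuation_eq_one
  -- `U = f(⊤)`, `V = f(M)`
  have hUtop : U = (⊤ : Subgroup (𝒪[K])ˣ).map f := by rw [← MonoidHom.range_eq_map, hrange]
  have hVM : V = M.map f := by
    ext u
    rw [hV, Subgroup.mem_map]
    constructor
    · rintro ⟨hu, hdep⟩
      obtain ⟨w, hw⟩ : u ∈ f.range := by rw [hrange, hU]; exact hu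
      refine ⟨w, ?_, hw⟩
      rw [hM, mem_depthSubgroup_iff hσ hϖ hσO]
      have hwu : ((w : 𝒪[K]) : K) = (u : K) := by rw [← hw]; rfl
      rwa [hwu]
    · rintro ⟨w, hw, rfl⟩
      rw [hM, mem_depthSubgroup_iff hσ hϖ hσO] at hw
      exact ⟨(hunit (w : 𝒪[K])).1 w.isUnit, hw⟩
  rw [hUtop, hVM, Subgroup.relIndex_map_map_of_injective _ _ hinj, Subgroup.relIndex_top_right, hM]
  exact index_depth_eq_pow hσ hfix hϖ hdd hσO hq j

/-- **SUCH SUBGROUPS EXIST** (the image of Mars' subgroup; no definition): for every level `k` there is `V ≤ Kˣ` with `u ∈ V ↔ |u| = 1 ∧ |σu − u| ≤ |ϖ^k|`.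
[cite: Serre1979, Ch. V §1] -/
theorem exists_subgroup_depth (hσ : ∀ x, σ (σ x) = x) (hvσ : ∀ a, Valued.v (σ a) = Valued.v a) (hϖ : Valued.v ϖ = exp (-1 : ℤ)) (k : ℕ) :
    ∃ V : Subgroup Kˣ, ∀ u, u ∈ V ↔ Valued.v (u : K) = 1 ∧ Valued.v (σ (u : K) - u) ≤ Valued.v (ϖ ^ k) := by
  obtain ⟨σO, hσO⟩ := exists_ringHom_integer hvσ
  have hunit : ∀ z : 𝒪[K], IsUnit z ↔ Valued.v (z : K) = 1 := fun z =>
    (Valuation.integer.integers (Valued.v (R := K))).isUnit_iff_valuation_eq_one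
  refine ⟨(((Units.map (Ideal.quotientMap (maximalIdeal 𝒪[K] ^ k) σO
            (maximalIdeal_pow_le_comap σO (ringHom_integer_involutive hσ hσO) k)).toMonoidHom).eqLocus (MonoidHom.id _)).comap
          (Units.map (Ideal.Quotient.mk (maximalIdeal 𝒪[K] ^ k)).toMonoidHom)).map (Units.map (𝒪[K]).subtype.toMonoidHom), fun u => ?_⟩
  rw [Subgroup.mem_map]
  constructor
  · rintro ⟨w, hw, rfl⟩
    rw [mem_depthSubgroup_iff hσ hϖ hσO] at hw
    exact ⟨(hunit (w : 𝒪[K])).1 w.isUnit, hw⟩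
  · rintro ⟨hu, hdep⟩
    obtain ⟨hrange, -⟩ := range_units_map_subtype (K := K) ((Units.map (𝒪[K]).subtype.toMonoidHom).range) (fun u' => by
      constructor
      · rintro ⟨w, rfl⟩; exact (hunit (w : 𝒪[K])).1 w.isUnit
      · intro hu'
        obtain ⟨w, hw⟩ := (hunit ⟨(u' : K), hu'.le⟩).2 hu'
        refine ⟨w, Units.ext ?_⟩
        have := congrArg (fun z : 𝒪[K] => (z : K)) hw
        simpa using this)
    obtain ⟨w, hw⟩ : u ∈ (Units.map (𝒪[K]).subtype.toMonoidHom).range := by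
      obtain ⟨w, hw'⟩ := (hunit ⟨(u : K), hu.le⟩).2 hu
      refine ⟨w, Units.ext ?_⟩
      have := congrArg (fun z : 𝒪[K] => (z : K)) hw'
      simpa using this
    refine ⟨w, ?_, hw⟩
    rw [mem_depthSubgroup_iff hσ hϖ hσO]
    have hwu : ((w : 𝒪[K]) : K) = (u : K) := by rw [← hw]; rfl
    rwa [hwu]

omit [IsDiscreteValuationRing 𝒪[K]] in
/-- **THE UNITS SUBGROUP EXISTS** in the same characterised form: `U ≤ Kˣ` with `u ∈ U ↔ |u| = 1`. [cite: Serre1979, Ch. V §1] -/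
theorem exists_subgroup_v_eq_one : ∃ U : Subgroup Kˣ, ∀ u, u ∈ U ↔ Valued.v (u : K) = 1 := by
  have hunit : ∀ z : 𝒪[K], IsUnit z ↔ Valued.v (z : K) = 1 := fun z =>
    (Valuation.integer.integers (Valued.v (R := K))).isUnit_iff_valuation_eq_one
  refine ⟨(Units.map (𝒪[K]).subtype.toMonoidHom).range, fun u => ⟨?_, fun hu => ?_⟩⟩
  · rintro ⟨w, rfl⟩; exact (hunit (w : 𝒪[K])).1 w.isUnit
  · obtain ⟨w, hw⟩ := (hunit ⟨(u : K), hu.le⟩).2 hu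
    refine ⟨w, Units.ext ?_⟩
    have := congrArg (fun z : 𝒪[K] => (z : K)) hw
    simpa using this

/-! ## §4 (ED. 2, append-only) The odd and the low levels in `Kˣ` — what a consumer needs to evaluate EVERY depth `k`:
`[U : V_{d+2j+1}] = q^{j+1}` (no odd steps) and `[U : V_k] = 1` for `k ≤ d` (depths `≤ d` are automatic) -/

/-- **ODD LEVELS IN `Kˣ`**: for `U = {|u| = 1}` and `V = {|u| = 1 ∧ |σu − u| ≤ |ϖ^{d+2j+1}|}`: `V.relIndex U = q^{j+1}` (★ §2 `index_depth_odd_eq_pow` transported along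
`𝒪[K]ˣ ↪ Kˣ` exactly as `relIndex_eq_pow_of_depth`). [cite: Serre1979, Ch. IV §1 Prop. 3, Ch. V §3] [cite: Flicker1998UnitaryFL, Prop. 7 p. 84] -/
theorem relIndex_eq_pow_of_depth_odd (hσ : ∀ x, σ (σ x) = x) (hvσ : ∀ a, Valued.v (σ a) = Valued.v a)
    (hfix : ∀ x : K, σ x = x → x ≠ 0 → ∃ n : ℤ, Valued.v x = exp (2 * n))
    (hϖ : Valued.v ϖ = exp (-1 : ℤ)) (hdd : Valued.v (ϖ - σ ϖ) = Valued.v ϖ ^ d)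
    [Finite 𝓀[K]] {q : ℕ} (hq : Nat.card 𝓀[K] = q) (j : ℕ) (U V : Subgroup Kˣ)
    (hU : ∀ u, u ∈ U ↔ Valued.v (u : K) = 1)
    (hV : ∀ u, u ∈ V ↔ Valued.v (u : K) = 1 ∧ Valued.v (σ (u : K) - u) ≤ Valued.v (ϖ ^ (d + (2 * j + 1)))) :
    V.relIndex U = q ^ (j + 1) := by
  obtain ⟨σO, hσO⟩ := exists_ringHom_integer hvσ
  set f : (𝒪[K])ˣ →* Kˣ := Units.map (𝒪[K]).subtype.toMonoidHom with hf
  set M : Subgroup (𝒪[K])ˣ :=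
    ((Units.map (Ideal.quotientMap (maximalIdeal 𝒪[K] ^ (d + (2 * j + 1))) σO
          (maximalIdeal_pow_le_comap σO (ringHom_integer_involutive hσ hσO) (d + (2 * j + 1)))).toMonoidHom).eqLocus (MonoidHom.id _)).comap
      (Units.map (Ideal.Quotient.mk (maximalIdeal 𝒪[K] ^ (d + (2 * j + 1)))).toMonoidHom) with hM
  obtain ⟨hrange, hinj⟩ := range_units_map_subtype (K := K) U hU
  have hunit : ∀ z : 𝒪[K], IsUnit z ↔ Valued.v (z : K) = 1 := fun z =>
    (Valuation.integer.integers (Valued.v (R := K))).isUnit_iff_valuation_eq_one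
  have hUtop : U = (⊤ : Subgroup (𝒪[K])ˣ).map f := by rw [← MonoidHom.range_eq_map, hrange]
  have hVM : V = M.map f := by
    ext u
    rw [hV, Subgroup.mem_map]
    constructor
    · rintro ⟨hu, hdep⟩
      obtain ⟨w, hw⟩ : u ∈ f.range := by rw [hrange, hU]; exact hu
      refine ⟨w, ?_, hw⟩
      rw [hM, mem_depthSubgroup_iff hσ hϖ hσO]
      have hwu : ((w : 𝒪[K]) : K) = (u : K) := by rw [← hw]; rfl
      rwa [hwu]
    · rintro ⟨w, hw, rfl⟩
      rw [hM, mem_depthSubgroup_iff hσ hϖ hσO] at hw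
      exact ⟨(hunit (w : 𝒪[K])).1 w.isUnit, hw⟩
  rw [hUtop, hVM, Subgroup.relIndex_map_map_of_injective _ _ hinj, Subgroup.relIndex_top_right, hM]
  exact index_depth_odd_eq_pow hσ hfix hϖ hdd hσO hq j

/-- **LOW LEVELS IN `Kˣ`**: for `k ≤ d`, `U = {|u| = 1}` and `V = {|u| = 1 ∧ |σu − u| ≤ |ϖ^k|}`: `V.relIndex U = 1` (every unit has `σ`-depth `≥ d`; ★ §2
`index_depth_eq_one_of_le`). [cite: Serre1979, Ch. IV §1 Prop. 4] -/
theorem relIndex_eq_one_of_depth_le (hσ : ∀ x, σ (σ x) = x) (hvσ : ∀ a, Valued.v (σ a) = Valued.v a)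
    (hfix : ∀ x : K, σ x = x → x ≠ 0 → ∃ n : ℤ, Valued.v x = exp (2 * n))
    (hϖ : Valued.v ϖ = exp (-1 : ℤ)) (hdd : Valued.v (ϖ - σ ϖ) = Valued.v ϖ ^ d)
    {k : ℕ} (hk : k ≤ d) (U V : Subgroup Kˣ)
    (hU : ∀ u, u ∈ U ↔ Valued.v (u : K) = 1)
    (hV : ∀ u, u ∈ V ↔ Valued.v (u : K) = 1 ∧ Valued.v (σ (u : K) - u) ≤ Valued.v (ϖ ^ k)) :
    V.relIndex U = 1 := by
  obtain ⟨σO, hσO⟩ := exists_ringHom_integer hvσ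
  set f : (𝒪[K])ˣ →* Kˣ := Units.map (𝒪[K]).subtype.toMonoidHom with hf
  set M : Subgroup (𝒪[K])ˣ :=
    ((Units.map (Ideal.quotientMap (maximalIdeal 𝒪[K] ^ k) σO
          (maximalIdeal_pow_le_comap σO (ringHom_integer_involutive hσ hσO) k)).toMonoidHom).eqLocus (MonoidHom.id _)).comap
      (Units.map (Ideal.Quotient.mk (maximalIdeal 𝒪[K] ^ k)).toMonoidHom) with hM
  obtain ⟨hrange, hinj⟩ := range_units_map_subtype (K := K) U hU
  have hunit : ∀ z : 𝒪[K], IsUnit z ↔ Valued.v (z : K) = 1 := fun z =>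
    (Valuation.integer.integers (Valued.v (R := K))).isUnit_iff_valuation_eq_one
  have hUtop : U = (⊤ : Subgroup (𝒪[K])ˣ).map f := by rw [← MonoidHom.range_eq_map, hrange]
  have hVM : V = M.map f := by
    ext u
    rw [hV, Subgroup.mem_map]
    constructor
    · rintro ⟨hu, hdep⟩
      obtain ⟨w, hw⟩ : u ∈ f.range := by rw [hrange, hU]; exact hu
      refine ⟨w, ?_, hw⟩
      rw [hM, mem_depthSubgroup_iff hσ hϖ hσO]
      have hwu : ((w : 𝒪[K]) : K) = (u : K) := by rw [← hw]; rfl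
      rwa [hwu]
    · rintro ⟨w, hw, rfl⟩
      rw [hM, mem_depthSubgroup_iff hσ hϖ hσO] at hw
      exact ⟨(hunit (w : 𝒪[K])).1 w.isUnit, hw⟩
  rw [hUtop, hVM, Subgroup.relIndex_map_map_of_injective _ _ hinj, Subgroup.relIndex_top_right, hM]
  exact index_depth_eq_one_of_le hσ hfix hϖ hdd hσO hk

end Index

end Literature.NumberTheory.LocalFields.WildQuadraticDatum
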